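import Summits.CriticalPhenomena.PercolationContinuityZ3.Theses.PercAxialLogConvexity
import Summits.CriticalPhenomena.PercolationContinuityZ3.Theorems.PercAxialLogConvexityBlockCrossoverStubAxialMass
import Summits.CriticalPhenomena.PercolationContinuityZ3.Theorems.PercAxialLogConvexityBlockCrossoverStubMassVanishes

/-!
# `BlockCrossover` from `AxialLogConvex` and near-critical scaling (conditional reduction)

Crux `BlockCrossover` (stmt-CriticalPhenomena-11550, route `PercAxialLogConvexity`), line
`registered`: its one open stub `stub_ratioCrossover` asks, with `a_p(n) = τ_p(0, n e₁)`,
`f_p = log a_p`, `m = m(p) = 1/ξ(p)` the axial mass (`HasInvCorrLength (tau 3 p 0) m`) and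
`N = ⌈c/m⌉₊`, for the block inequality
`(f_p(n) - f_p(n+1)) - (f_{p_c}(n) - f_{p_c}(n+1)) ≤ c'/N` on `N/2 ≤ n ≤ N` — a comparison of
EFFECTIVE MASSES (discrete log-derivatives) at the correlation scale. This file proves it, for all
`p` close to `p_c`, from:

* `AxialLogConvex` — the route's other crux (stmt-CriticalPhenomena-11549): `n ↦ f_p(n)` convex for
  every `p ≤ p_c`;
* (RV) regular variation of the critical axial function: `f_{p_c}(m) - f_{p_c}(n) + κ log (m/n) → 0`
  uniformly for `n/2 ≤ m ≤ 2n` (i.e. `τ_{p_c}(0, n e₁) = n^{-κ} ℓ(n)`, `ℓ` slowly varying; `κ = 1 + η`);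
* (SC) a function-level scaling form of the crossover deficit at the correlation scale:
  `(f_{p_c}(n) - f_p(n)) - D(n m(p)) → 0` as `p ↑ p_c`, uniformly for `n m(p)` in compacts of `(0,∞)`;
* (SL) the scaling function has slope `< 1` around one dyadic block:
  `D t - D t' ≤ θ (t - t')` for `c₀/8 ≤ t' ≤ t ≤ 2 c₀`, some `c₀ > 0`, `θ < 1`
  (scaling theory: `D(t) ≍ t^{1/ν}` as `t → 0` with `1/ν ≈ 1.141 > 1` on `ℤ³`, so every small `c₀` works;
  in `d = 2`, `1/ν = 3/4` and (SL) fails).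

Mechanism (`ratioCrossover_of_axialLogConvex_of_scaling`): convexity sandwiches the effective
masses between one-sided difference quotients over `k = ⌊ε n⌋₊` steps,
`s_p(n) ≤ (f_p(n-k) - f_p(n))/k`, `s_{p_c}(n) ≥ (f_{p_c}(n+1) - f_{p_c}(n+1+k))/k`, so that
`δ_p(n) ≤ [Curv_k(n) + D_p(n) - D_p(n-k)]/k` with the critical curvature
`Curv_k(n) = f_{p_c}(n-k) - f_{p_c}(n) - f_{p_c}(n+1) + f_{p_c}(n+1+k) = -κ log(1 - k(k+1)/(n(n+1))) + o(1)
= O(κ ε²) + o(1)` by (RV), and `D_p(n) - D_p(n-k) ≤ θ k m + o(1)` by (SC)+(SL); hence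
`N δ_p(n) ≤ θ c₀ + O(ε) + o(1)/ε < c' := (1+θ) c₀/2 < c₀` for `ε` small and `p` close to `p_c`
(`m(p) → 0` by the landed `stub_massVanishes`). Function-level scaling alone does NOT control
ratios; log-convexity is what upgrades it — so within route `PercAxialLogConvexity` the second crux
costs exactly the standard scaling picture (RV)+(SC) plus the `ν < 1` signature (SL).

Main results: `ratioCrossover_of_axialLogConvex_of_scaling` (the stub's statement, in the stronger
"for all `p` near `p_c`" form) and `blockCrossover_of_axialLogConvex_of_scaling` (the crux, by the
line's composition with the landed `stub_axialMass`, `stub_massVanishes`).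

Scope / strength of the hypotheses. (RV) is stated with `κ : ℝ` UNRESTRICTED (in a `θ(p_c) > 0`
world `τ_{p_c}(0, n e₁) → θ(p_c)² > 0` and (RV) holds with `κ = 0`); read with `κ > 0` it ALONE gives
`τ_{p_c}(0, n e₁) → 0`, hence `τ_{p_c}(0, x) → 0` (`sq_le_tau_axis`) and `PercolationContinuityZ3`
(`percolationContinuity_iff_tendsto_tau`) — the scaling inputs are conjunct-strength, as the route
concedes for this crux. The reduction LOCATES which scaling statements `BlockCrossover` consumes
beyond `AxialLogConvex` (function-level crossover scaling at scale `ξ` + the `ν < 1` slope signature);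
it does not make the route cheaper, and none of (RV), (SC), (SL) is known on `ℤ³`
(GrimmettPercolation1999 Ch. 9–10: only `d = 2` (Kesten 1987) and mean-field `d ≥ 19`/spread-out
results; (SL) is FALSE in `d = 2`, where `1/ν = 3/4`).
-/

noncomputable section

namespace Summit.CriticalPhenomena.PercolationContinuityZ3.Theorems.BlockCrossover

open MeasureTheory Filter Topology
open Literature.Probability.Percolation Literature.Probability.LatticeModels

namespace Conditional

/-! ### Convex sequences: one-sided difference quotients sandwich the slope -/

/-- Slopes of a convex sequence are non-decreasing. -/
theorem slope_mono (f : ℕ → ℝ) (hcx : ∀ j, f (j + 1) - f j ≤ f (j + 2) - f (j + 1)) :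
    ∀ i d : ℕ, f (i + 1) - f i ≤ f (i + d + 1) - f (i + d) := by
  intro i d
  induction d with
  | zero => simp
  | succ d ih =>
    have h := hcx (i + d)
    have e1 : i + (d + 1) + 1 = i + d + 2 := by omega
    have e2 : i + (d + 1) = i + d + 1 := by omega
    rw [e1, e2]
    linarith

/-- Backward quotient bound: `k (f(i+k) - f(i+k+1)) ≤ f(i) - f(i+k)` for a convex sequence
(the slope at `i+k` dominates the average slope over `[i, i+k]`). -/
theorem backward_sandwich (f : ℕ → ℝ) (hcx : ∀ j, f (j + 1) - f j ≤ f (j + 2) - f (j + 1)) :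
    ∀ i k : ℕ, (k : ℝ) * (f (i + k) - f (i + k + 1)) ≤ f i - f (i + k) := by
  intro i k
  induction k with
  | zero => simp
  | succ k ih =>
    -- slope at `i+k` ≤ slope at `i+k+1`
    have h1 : f (i + k + 1) - f (i + k) ≤ f (i + k + 2) - f (i + k + 1) := hcx (i + k)
    have hk : (0 : ℝ) ≤ k := Nat.cast_nonneg k
    have hmul : (k : ℝ) * (f (i + k + 1) - f (i + k + 2)) ≤ (k : ℝ) * (f (i + k) - f (i + k + 1)) :=
      mul_le_mul_of_nonneg_left (by linarith) hk
    have e2 : i + (k + 1) + 1 = i + k + 2 := by omega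
    have e1 : i + (k + 1) = i + k + 1 := by omega
    rw [e2, e1]
    push_cast
    nlinarith [ih, h1, hmul]

/-- Forward quotient bound: `f(n+1) - f(n+1+k) ≤ k (f(n) - f(n+1))` for a convex sequence
(the slope at `n` is dominated by every later slope). -/
theorem forward_sandwich (f : ℕ → ℝ) (hcx : ∀ j, f (j + 1) - f j ≤ f (j + 2) - f (j + 1)) :
    ∀ n k : ℕ, f (n + 1) - f (n + 1 + k) ≤ (k : ℝ) * (f n - f (n + 1)) := by
  intro n k
  induction k with
  | zero => simp
  | succ k ih =>
    have h1 : f (n + 1) - f n ≤ f (n + k + 2) - f (n + k + 1) := by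
      have h := slope_mono f hcx n (k + 1)
      have e1 : n + (k + 1) + 1 = n + k + 2 := by omega
      have e2 : n + (k + 1) = n + k + 1 := by omega
      rw [e1, e2] at h
      exact h
    have ih' : f (n + 1) - f (n + k + 1) ≤ (k : ℝ) * (f n - f (n + 1)) := by
      have e0 : n + 1 + k = n + k + 1 := by omega
      rw [e0] at ih
      exact ih
    have e3 : n + 1 + (k + 1) = n + k + 2 := by omega
    rw [e3]
    push_cast
    linarith

/-- Log-convexity of a positive sequence gives convexity of its logarithm. -/
theorem log_convex_of_sq_le (a : ℕ → ℝ) (hpos : ∀ n, 0 < a n)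
    (hlcx : ∀ n, a (n + 1) ^ 2 ≤ a n * a (n + 2)) :
    ∀ j, Real.log (a (j + 1)) - Real.log (a j) ≤ Real.log (a (j + 2)) - Real.log (a (j + 1)) := by
  intro j
  have h := Real.log_le_log (pow_pos (hpos (j + 1)) 2) (hlcx j)
  rw [Real.log_pow, Real.log_mul (hpos j).ne' (hpos (j + 2)).ne'] at h
  push_cast at h
  linarith


/-! ### The two analytic estimates -/

/-- **Convexity sandwich.** For convex `f` (subcritical) and `F` (critical) and `n = i + k`:
`k · δ(n) ≤ Curv + (Dp(n) - Dp(i))`, where `δ(n) = (f n - f (n+1)) - (F n - F (n+1))` is the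
deficit increment, `Curv = F i - F n - F (n+1) + F (n+1+k)` the critical curvature over `k` steps
and `Dp = F - f` the deficit. -/
theorem increment_bound (F f : ℕ → ℝ)
    (hF : ∀ j, F (j + 1) - F j ≤ F (j + 2) - F (j + 1))
    (hf : ∀ j, f (j + 1) - f j ≤ f (j + 2) - f (j + 1)) (i k : ℕ) :
    (k : ℝ) * ((f (i + k) - f (i + k + 1)) - (F (i + k) - F (i + k + 1))) ≤
      (F i - F (i + k) - F (i + k + 1) + F (i + k + 1 + k)) +
        ((F (i + k) - f (i + k)) - (F i - f i)) := by
  have h1 := backward_sandwich f hf i k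
  have h2 := forward_sandwich F hF (i + k) k
  nlinarith [h1, h2]

/-- **Critical curvature bound from regular variation.** With `n = i + k`, `1 ≤ i`,
`2 k (k+1) ≤ n (n+1)` and `k (k + 1) ≤ 2 ε² n (n + 1)`, the three regular-variation estimates at
`i`, `n + 1 + k`, `n + 1` (base point `n`) give `Curv ≤ 4 |κ| ε² + 3 ε₁`, because
`i (n+1+k) = n (n+1) - k (k+1)` and `-log (1 - x) ≤ 2 x`. -/
theorem curv_bound (F : ℕ → ℝ) (κ ε ε₁ : ℝ) (i k : ℕ) (hi : 1 ≤ i)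
    (hx1 : 2 * ((k : ℝ) * (k + 1)) ≤ ((i + k : ℕ) : ℝ) * ((i + k : ℕ) + 1))
    (hx2 : (k : ℝ) * (k + 1) ≤ 2 * ε ^ 2 * (((i + k : ℕ) : ℝ) * ((i + k : ℕ) + 1)))
    (h1 : |F i - F (i + k) + κ * Real.log ((i : ℝ) / ((i + k : ℕ) : ℝ))| ≤ ε₁)
    (h2 : |F (i + k + 1 + k) - F (i + k) +
        κ * Real.log (((i + k + 1 + k : ℕ) : ℝ) / ((i + k : ℕ) : ℝ))| ≤ ε₁)
    (h3 : |F (i + k + 1) - F (i + k) + κ * Real.log (((i + k + 1 : ℕ) : ℝ) / ((i + k : ℕ) : ℝ))| ≤ ε₁) :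
    F i - F (i + k) - F (i + k + 1) + F (i + k + 1 + k) ≤ 4 * |κ| * ε ^ 2 + 3 * ε₁ := by
  -- abbreviations (as reals)
  set n : ℝ := ((i + k : ℕ) : ℝ) with hn
  have hi0 : (0 : ℝ) < i := by exact_mod_cast hi
  have hk0 : (0 : ℝ) ≤ k := Nat.cast_nonneg k
  have hn_eq : n = (i : ℝ) + k := by rw [hn]; push_cast; ring
  have hn0 : 0 < n := by rw [hn_eq]; linarith
  have hn1 : 0 < n + 1 := by linarith
  -- the product identity
  set x : ℝ := (k : ℝ) * (k + 1) / (n * (n + 1)) with hx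
  have hnn1 : 0 < n * (n + 1) := mul_pos hn0 hn1
  have hx0 : 0 ≤ x := div_nonneg (by positivity) hnn1.le
  have hxhalf : x ≤ 1 / 2 := by
    rw [hx, div_le_iff₀ hnn1]; linarith
  have hxeps : x ≤ 2 * ε ^ 2 := by
    rw [hx, div_le_iff₀ hnn1]; linarith
  have hprod : (i : ℝ) * (((i + k + 1 + k : ℕ) : ℝ)) / (n * (n + 1)) = 1 - x := by
    have e : (((i + k + 1 + k : ℕ) : ℝ)) = n + 1 + k := by rw [hn_eq]; push_cast; ring
    rw [e, hx, eq_sub_iff_add_eq, ← add_div, div_eq_one_iff_eq hnn1.ne', hn_eq]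
    ring
  -- combine the three logarithms
  have hlogsum : Real.log ((i : ℝ) / n) + Real.log (((i + k + 1 + k : ℕ) : ℝ) / n) -
      Real.log (((i + k + 1 : ℕ) : ℝ) / n) = Real.log (1 - x) := by
    have e3 : (((i + k + 1 : ℕ) : ℝ)) = n + 1 := by rw [hn_eq]; push_cast; ring
    have hm0 : (0 : ℝ) < ((i + k + 1 + k : ℕ) : ℝ) := by positivity
    rw [e3, ← hprod, Real.log_div hi0.ne' hn0.ne', Real.log_div hm0.ne' hn0.ne',
      Real.log_div hn1.ne' hn0.ne', Real.log_div (mul_pos hi0 hm0).ne' hnn1.ne',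
      Real.log_mul hi0.ne' hm0.ne', Real.log_mul hn0.ne' hn1.ne']
    ring
  -- `-κ log (1 - x) ≤ 4 |κ| ε²`
  have hlog1x : -Real.log (1 - x) ≤ 2 * x := by
    -- `-log (1 - x) ≤ (1 - x)⁻¹ - 1 ≤ 2 x` on `[0, 1/2]` (cf. `DFI1995.neg_log_one_sub_le`)
    have hpos : 0 < 1 - x := by linarith
    have h := Real.one_sub_inv_le_log_of_pos hpos
    have hinv : (1 - x)⁻¹ ≤ 1 + 2 * x := by
      rw [inv_le_iff_one_le_mul₀ hpos]
      nlinarith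
    linarith
  have hlog1x' : Real.log (1 - x) ≤ 0 := Real.log_nonpos (by linarith) (by linarith)
  have hκ : -(κ * Real.log (1 - x)) ≤ 4 * |κ| * ε ^ 2 := by
    rcases le_or_gt 0 κ with hκ0 | hκ0
    · rw [abs_of_nonneg hκ0]
      nlinarith
    · rw [abs_of_neg hκ0]
      nlinarith
  -- unpack the absolute values
  have h1' := (abs_le.1 h1).2
  have h2' := (abs_le.1 h2).2
  have h3' := (abs_le.1 h3).1
  have key : F i - F (i + k) - F (i + k + 1) + F (i + k + 1 + k) ≤
      -(κ * (Real.log ((i : ℝ) / n) + Real.log (((i + k + 1 + k : ℕ) : ℝ) / n) -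
        Real.log (((i + k + 1 : ℕ) : ℝ) / n))) + 3 * ε₁ := by
    nlinarith [h1', h2', h3']
  rw [hlogsum] at key
  linarith

/-! ### The conditional theorem -/

/-- **`RatioCrossover` from `AxialLogConvex` + (RV) + (SC) + (SL)** — the statement of the stub
`stub_ratioCrossover` of line `registered`, in the stronger form "for ALL `p` close to `p_c`":
there are `0 < c` and `c' < c` and `p₁ < p_c` such that for every `p ∈ (p₁, p_c)`, with `m` the
axial mass of `p` and `N = ⌈c/m⌉₊`, the block inequality
`e^{-c'/N} τ_p(0,n e₁) τ_{p_c}(0,(n+1)e₁) ≤ τ_p(0,(n+1)e₁) τ_{p_c}(0,n e₁)` holds for `N/2 ≤ n ≤ N`.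
Constants: `c = c₀`, `c' = θ⁺ c + (1-θ⁺) c/2` with `θ⁺ = max θ 0`. -/
theorem ratioCrossover_of_axialLogConvex_of_scaling
    (hLCX : Summit.CriticalPhenomena.PercolationContinuityZ3.Theses.PercAxialLogConvexity.AxialLogConvex)
    (κ : ℝ)
    (hRV : ∀ ε : ℝ, 0 < ε → ∃ n₀ : ℕ, ∀ n j : ℕ, n₀ ≤ n → n ≤ 2 * j → j ≤ 2 * n →
      |Real.log (tau 3 (criticalProbI 3) 0 (Pi.single 0 (j : ℤ))) -
          Real.log (tau 3 (criticalProbI 3) 0 (Pi.single 0 (n : ℤ))) +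
        κ * Real.log ((j : ℝ) / n)| ≤ ε)
    (D : ℝ → ℝ)
    (hSC : ∀ lo hi : ℝ, 0 < lo → lo < hi → ∀ ε : ℝ, 0 < ε → ∃ p₀ : unitInterval,
      p₀ < criticalProbI 3 ∧ ∀ p : unitInterval, p₀ < p → p < criticalProbI 3 →
        ∀ m : ℝ, HasInvCorrLength (tau 3 p 0) m → ∀ n : ℕ, lo ≤ n * m → n * m ≤ hi →
          |(Real.log (tau 3 (criticalProbI 3) 0 (Pi.single 0 (n : ℤ))) -
              Real.log (tau 3 p 0 (Pi.single 0 (n : ℤ)))) - D (n * m)| ≤ ε)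
    (c₀ θ : ℝ) (hc₀ : 0 < c₀) (hθ : θ < 1)
    (hSL : ∀ t t' : ℝ, c₀ / 8 ≤ t' → t' ≤ t → t ≤ 2 * c₀ → D t - D t' ≤ θ * (t - t')) :
    ∃ c c' : ℝ, 0 < c ∧ c' < c ∧ ∃ p₁ : unitInterval, p₁ < criticalProbI 3 ∧
      ∀ p : unitInterval, p₁ < p → p < criticalProbI 3 →
        ∀ m : ℝ, 0 < m → HasInvCorrLength (tau 3 p 0) m →
          ∀ n : ℕ, ((⌈c / m⌉₊ : ℕ) : ℝ) ≤ 2 * n → n ≤ ⌈c / m⌉₊ →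
            Real.exp (-(c' / (⌈c / m⌉₊ : ℕ))) *
                (tau 3 p 0 (Pi.single 0 (n : ℤ)) *
                  tau 3 (criticalProbI 3) 0 (Pi.single 0 ((n + 1 : ℕ) : ℤ))) ≤
              tau 3 p 0 (Pi.single 0 ((n + 1 : ℕ) : ℤ)) *
                tau 3 (criticalProbI 3) 0 (Pi.single 0 (n : ℤ)) := by
  -- constants
  obtain ⟨θ', hθ'0, hθ'1, hθθ'⟩ : ∃ θ' : ℝ, 0 ≤ θ' ∧ θ' < 1 ∧ θ ≤ θ' :=
    ⟨max θ 0, le_max_right _ _, max_lt hθ one_pos, le_max_left _ _⟩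
  obtain ⟨g, hg⟩ : ∃ g : ℝ, g = (1 - θ') * c₀ / 2 := ⟨_, rfl⟩
  have hgpos : 0 < g := by
    rw [hg]
    have : 0 < 1 - θ' := by linarith
    positivity
  obtain ⟨c', hc'⟩ : ∃ c' : ℝ, c' = θ' * c₀ + g := ⟨_, rfl⟩
  have hc'c : c' < c₀ := by
    have h := mul_pos (sub_pos.2 hθ'1) hc₀
    rw [hc', hg]
    nlinarith only [h]
  obtain ⟨A, hA⟩ : ∃ A : ℝ, A = 16 * |κ| + 20 := ⟨_, rfl⟩
  have hApos : 0 < A := by rw [hA]; positivity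
  obtain ⟨ε, hε⟩ : ∃ ε : ℝ, ε = min (1 / 4) (g / (2 * A)) := ⟨_, rfl⟩
  have hεpos : 0 < ε := by rw [hε]; exact lt_min (by norm_num) (div_pos hgpos (by positivity))
  have hε4 : ε ≤ 1 / 4 := by rw [hε]; exact min_le_left _ _
  have hεA : A * ε ≤ g / 2 := by
    have h : ε ≤ g / (2 * A) := by rw [hε]; exact min_le_right _ _
    rw [le_div_iff₀ (by positivity)] at h
    linarith
  -- (RV) at tolerance ε²
  obtain ⟨n₀, hn₀⟩ := hRV (ε ^ 2) (by positivity)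
  have hn₀0 : (0 : ℝ) ≤ n₀ := Nat.cast_nonneg n₀
  -- (SC) on [c₀/8, 2c₀] at tolerance ε²
  obtain ⟨p₀, hp₀, hSC'⟩ :=
    hSC (c₀ / 8) (2 * c₀) (by positivity) (by linarith) (ε ^ 2) (by positivity)
  -- smallness of the mass (landed `stub_massVanishes`)
  obtain ⟨p₀', hp₀', hmass⟩ :=
    stub_massVanishes (min (min (ε * c₀ / 4) (g / 2)) (c₀ / (2 * ((n₀ : ℝ) + 8)))) (by positivity)
  refine ⟨c₀, c', hc₀, hc'c, max p₀ p₀', max_lt hp₀ hp₀', ?_⟩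
  intro p hp₁ hppc m hm hicl n hNn hnN
  have hp₀p : p₀ < p := lt_of_le_of_lt (le_max_left _ _) hp₁
  have hp₀'p : p₀' < p := lt_of_le_of_lt (le_max_right _ _) hp₁
  have hmm₀ := hmass p hp₀'p hppc m hicl
  have hm1 : m ≤ ε * c₀ / 4 := hmm₀.le.trans ((min_le_left _ _).trans (min_le_left _ _))
  have hm2 : m ≤ g / 2 := hmm₀.le.trans ((min_le_left _ _).trans (min_le_right _ _))
  have hm3 : m ≤ c₀ / (2 * ((n₀ : ℝ) + 8)) := hmm₀.le.trans (min_le_right _ _)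
  clear hmm₀ hmass
  have hmc4 : m ≤ c₀ / 4 := by
    have h : ε * c₀ ≤ 1 * c₀ := mul_le_mul_of_nonneg_right (by linarith) hc₀.le
    linarith
  -- the scale `N = ⌈c₀/m⌉₊` (made opaque)
  have hcm : 0 < c₀ / m := div_pos hc₀ hm
  have hNge' : c₀ / m ≤ ((⌈c₀ / m⌉₊ : ℕ) : ℝ) := Nat.le_ceil _
  have hNlt' : ((⌈c₀ / m⌉₊ : ℕ) : ℝ) < c₀ / m + 1 := Nat.ceil_lt_add_one hcm.le
  generalize hNdef : ⌈c₀ / m⌉₊ = N at hNge' hNlt' hNn hnN ⊢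
  have hNge : c₀ / m ≤ (N : ℝ) := hNge'
  have hNlt : (N : ℝ) < c₀ / m + 1 := hNlt'
  clear hNge' hNlt'
  have hNpos : (0 : ℝ) < N := lt_of_lt_of_le hcm hNge
  have hNm_ge : c₀ ≤ (N : ℝ) * m := by rwa [div_le_iff₀ hm] at hNge
  have hNm_lt : (N : ℝ) * m < c₀ + m := by
    have h := mul_lt_mul_of_pos_right hNlt hm
    rwa [add_mul, div_mul_cancel₀ c₀ hm.ne', one_mul] at h
  -- `n` as a real; bounds on `t = n m`
  have hn_le : (n : ℝ) ≤ N := by exact_mod_cast hnN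
  have hn0 : (0 : ℝ) ≤ n := Nat.cast_nonneg n
  have hnm_hi : (n : ℝ) * m ≤ c₀ + m := by
    have h := mul_le_mul_of_nonneg_right hn_le hm.le
    linarith
  have hnm_lo : c₀ / 2 ≤ (n : ℝ) * m := by
    have h := mul_le_mul_of_nonneg_right hNn hm.le
    have e : 2 * (n : ℝ) * m = 2 * (n * m) := by ring
    linarith
  have hn_lo : c₀ / (2 * m) ≤ n := by
    have e : (n : ℝ) * (2 * m) = 2 * (n * m) := by ring
    rw [div_le_iff₀ (by positivity), e]
    linarith
  -- `n` is large: `n ≥ n₀ + 8`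
  have hn_big : (n₀ : ℝ) + 8 ≤ n := by
    have h1 : (n₀ : ℝ) + 8 ≤ c₀ / (2 * m) := by
      rw [le_div_iff₀ (by positivity)]
      have h := hm3
      rw [le_div_iff₀ (by positivity)] at h
      linarith
    linarith
  have hn8 : (8 : ℝ) ≤ n := by linarith
  have hnn₀ : n₀ ≤ n := by
    have : (n₀ : ℝ) ≤ n := by linarith
    exact_mod_cast this
  -- `k = ⌊ε n⌋₊` (made opaque) and `i = n - k`
  have hεn : 2 ≤ ε * n := by
    have h1 : ε * (c₀ / (2 * m)) ≤ ε * n := mul_le_mul_of_nonneg_left hn_lo hεpos.le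
    have h2 : 2 ≤ ε * (c₀ / (2 * m)) := by
      rw [mul_div_assoc', le_div_iff₀ (by positivity)]
      linarith
    linarith
  have hk_le' : ((⌊ε * n⌋₊ : ℕ) : ℝ) ≤ ε * n := Nat.floor_le (by positivity)
  have hk_gt' : ε * n < ((⌊ε * n⌋₊ : ℕ) : ℝ) + 1 := Nat.lt_floor_add_one _
  generalize hkdef : ⌊ε * n⌋₊ = k at hk_le' hk_gt'
  have hk_le : (k : ℝ) ≤ ε * n := hk_le'
  have hk_gt : ε * n < k + 1 := hk_gt'
  clear hk_le' hk_gt'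
  have hk_ge1 : (1 : ℝ) ≤ k := by linarith
  have hk_half : ε * n / 2 ≤ k := by linarith
  have hkpos : (0 : ℝ) < k := by linarith
  have hk_n4 : (k : ℝ) ≤ n / 4 := by
    have h := mul_le_mul_of_nonneg_right hε4 hn0
    linarith
  have hkn : k ≤ n := by
    have : (k : ℝ) ≤ n := by linarith
    exact_mod_cast this
  obtain ⟨i, hik⟩ : ∃ i : ℕ, i + k = n := ⟨n - k, Nat.sub_add_cancel hkn⟩
  have hi_real : (i : ℝ) = n - k := by
    have : ((i + k : ℕ) : ℝ) = n := by rw [hik]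
    push_cast at this
    linarith
  have hi_ge : (3 : ℝ) / 4 * n ≤ i := by rw [hi_real]; linarith
  have hi1 : 1 ≤ i := by
    have : (1 : ℝ) ≤ i := by linarith
    exact_mod_cast this
  -- the sequences
  have hp0 : 0 < (p : ℝ) := lt_of_le_of_lt (unitInterval.nonneg p₀) (Subtype.coe_lt_coe.2 hp₀p)
  have hpc0 : 0 < ((criticalProbI 3 : unitInterval) : ℝ) := by
    rw [coe_criticalProbI]; exact_mod_cast criticalProb_zd_pos 3 (by norm_num)
  obtain ⟨a, ha⟩ : ∃ a : ℕ → ℝ, a = fun j : ℕ => tau 3 p 0 (Pi.single 0 (j : ℤ)) := ⟨_, rfl⟩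
  obtain ⟨b, hb⟩ : ∃ b : ℕ → ℝ, b = fun j : ℕ => tau 3 (criticalProbI 3) 0 (Pi.single 0 (j : ℤ)) :=
    ⟨_, rfl⟩
  have hapos : ∀ j, 0 < a j := fun j => by
    rw [ha]; exact StubAxialMass.tau_axial_pos (d := 3) p hp0 j
  have hbpos : ∀ j, 0 < b j := fun j => by
    rw [hb]; exact StubAxialMass.tau_axial_pos (d := 3) (criticalProbI 3) hpc0 j
  obtain ⟨f, hf⟩ : ∃ f : ℕ → ℝ, f = fun j : ℕ => Real.log (a j) := ⟨_, rfl⟩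
  obtain ⟨F, hF⟩ : ∃ F : ℕ → ℝ, F = fun j : ℕ => Real.log (b j) := ⟨_, rfl⟩
  have hfcx : ∀ j, f (j + 1) - f j ≤ f (j + 2) - f (j + 1) := by
    rw [hf]
    refine log_convex_of_sq_le a hapos fun j => ?_
    have h := hLCX p hppc.le j
    simp only [ha]
    exact h
  have hFcx : ∀ j, F (j + 1) - F j ≤ F (j + 2) - F (j + 1) := by
    rw [hF]
    refine log_convex_of_sq_le b hbpos fun j => ?_
    have h := hLCX (criticalProbI 3) le_rfl j
    simp only [hb]
    exact h
  -- Step A: the convexity sandwich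
  have hA' := increment_bound F f hFcx hfcx i k
  rw [hik] at hA'
  -- Step B: the critical curvature
  have hx1 : 2 * ((k : ℝ) * (k + 1)) ≤ ((i + k : ℕ) : ℝ) * ((i + k : ℕ) + 1) := by
    rw [hik]
    have h := mul_le_mul hk_n4 (show (k : ℝ) + 1 ≤ n / 4 + 1 by linarith) (by positivity)
      (by positivity)
    nlinarith only [h, hn0]
  have hx2 : (k : ℝ) * (k + 1) ≤ 2 * ε ^ 2 * (((i + k : ℕ) : ℝ) * ((i + k : ℕ) + 1)) := by
    rw [hik]
    have h1 : (k : ℝ) + 1 ≤ 2 * ε * (n + 1) := by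
      have e : 2 * ε * ((n : ℝ) + 1) = 2 * (ε * n) + 2 * ε := by ring
      rw [e]
      linarith
    calc (k : ℝ) * (k + 1) ≤ (ε * n) * (2 * ε * (n + 1)) :=
          mul_le_mul hk_le h1 (by positivity) (by positivity)
      _ = 2 * ε ^ 2 * ((n : ℝ) * (n + 1)) := by ring
  have hRVF : ∀ j : ℕ, n ≤ 2 * j → j ≤ 2 * n →
      |F j - F n + κ * Real.log ((j : ℝ) / n)| ≤ ε ^ 2 := by
    intro j h1 h2
    have h := hn₀ n j hnn₀ h1 h2
    simp only [hF, hb]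
    exact h
  have hRV1 : |F i - F (i + k) + κ * Real.log ((i : ℝ) / ((i + k : ℕ) : ℝ))| ≤ ε ^ 2 := by
    rw [hik]
    refine hRVF i ?_ ?_
    · have : (n : ℝ) ≤ 2 * i := by linarith
      exact_mod_cast this
    · have : (i : ℝ) ≤ 2 * n := by rw [hi_real]; linarith
      exact_mod_cast this
  have hRV2 : |F (i + k + 1 + k) - F (i + k) +
      κ * Real.log (((i + k + 1 + k : ℕ) : ℝ) / ((i + k : ℕ) : ℝ))| ≤ ε ^ 2 := by
    rw [hik]
    refine hRVF (n + 1 + k) (by omega) ?_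
    have : ((n + 1 + k : ℕ) : ℝ) ≤ 2 * n := by push_cast; linarith
    exact_mod_cast this
  have hRV3 : |F (i + k + 1) - F (i + k) +
      κ * Real.log (((i + k + 1 : ℕ) : ℝ) / ((i + k : ℕ) : ℝ))| ≤ ε ^ 2 := by
    rw [hik]
    refine hRVF (n + 1) (by omega) ?_
    have : ((n + 1 : ℕ) : ℝ) ≤ 2 * n := by push_cast; linarith
    exact_mod_cast this
  have hB := curv_bound F κ ε (ε ^ 2) i k hi1 hx1 hx2 hRV1 hRV2 hRV3
  rw [hik] at hB
  -- Step C: the deficit difference via (SC) and (SL)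
  have ht_n_lo : c₀ / 8 ≤ (n : ℝ) * m := by linarith
  have ht_n_hi : (n : ℝ) * m ≤ 2 * c₀ := by linarith
  have ht_i_hi : (i : ℝ) * m ≤ (n : ℝ) * m := by
    have h := mul_nonneg hkpos.le hm.le
    rw [hi_real, sub_mul]
    linarith
  have ht_i_lo : c₀ / 8 ≤ (i : ℝ) * m := by
    have h1 : (3 : ℝ) / 4 * n * m ≤ i * m := mul_le_mul_of_nonneg_right hi_ge hm.le
    have e : (3 : ℝ) / 4 * n * m = 3 / 4 * (n * m) := by ring
    linarith
  have hSCn := hSC' p hp₀p hppc m hicl n ht_n_lo ht_n_hi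
  have hSCi := hSC' p hp₀p hppc m hicl i ht_i_lo (ht_i_hi.trans ht_n_hi)
  have hSLni := hSL ((n : ℝ) * m) ((i : ℝ) * m) ht_i_lo ht_i_hi ht_n_hi
  have hC : (F n - f n) - (F i - f i) ≤ 2 * ε ^ 2 + θ' * (k * m) := by
    have e : (n : ℝ) * m - i * m = k * m := by rw [hi_real]; ring
    rw [e] at hSLni
    have h1 := (abs_le.1 hSCn).2
    have h2 := (abs_le.1 hSCi).1
    have h3 : θ * (k * m) ≤ θ' * (k * m) := mul_le_mul_of_nonneg_right hθθ' (by positivity)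
    have eFn : F n - f n = Real.log (tau 3 (criticalProbI 3) 0 (Pi.single 0 (n : ℤ))) -
        Real.log (tau 3 p 0 (Pi.single 0 (n : ℤ))) := by simp only [hF, hf, hb, ha]
    have eFi : F i - f i = Real.log (tau 3 (criticalProbI 3) 0 (Pi.single 0 (i : ℤ))) -
        Real.log (tau 3 p 0 (Pi.single 0 (i : ℤ))) := by simp only [hF, hf, hb, ha]
    rw [eFn, eFi]
    linarith only [h1, h2, h3, hSLni]
  -- Step D: combine; `δ` is the deficit increment at `n`
  obtain ⟨δ, hδ⟩ : ∃ δ : ℝ, δ = (f n - f (n + 1)) - (F n - F (n + 1)) := ⟨_, rfl⟩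
  have hkδ : (k : ℝ) * δ ≤ (A / 4) * ε ^ 2 + θ' * (k * m) := by
    have hX : 4 * |κ| * ε ^ 2 + 3 * ε ^ 2 + 2 * ε ^ 2 = (A / 4) * ε ^ 2 := by rw [hA]; ring
    rw [hδ, ← hX]
    linarith only [hA', hB, hC]
  have hNδ : (N : ℝ) * δ ≤ c' := by
    have hNk : (N : ℝ) * ((A / 4) * ε ^ 2) ≤ k * (A * ε) := by
      have h1 : (N : ℝ) * ((A / 4) * ε ^ 2) ≤ (2 * n) * ((A / 4) * ε ^ 2) :=
        mul_le_mul_of_nonneg_right hNn (by positivity)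
      have h2 : (2 * (n : ℝ)) * ((A / 4) * ε ^ 2) = (ε * n / 2) * (A * ε) := by ring
      have h3 : (ε * n / 2) * (A * ε) ≤ k * (A * ε) :=
        mul_le_mul_of_nonneg_right hk_half (by positivity)
      linarith only [h1, h2, h3]
    have h5 : (N : ℝ) * ((k : ℝ) * δ) ≤ N * ((A / 4) * ε ^ 2 + θ' * (k * m)) :=
      mul_le_mul_of_nonneg_left hkδ hNpos.le
    have h6 : (N : ℝ) * (θ' * (k * m)) ≤ k * (θ' * (c₀ + m)) := by
      have h7 : θ' * (k : ℝ) * ((N : ℝ) * m) ≤ θ' * k * (c₀ + m) :=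
        mul_le_mul_of_nonneg_left hNm_lt.le (by positivity)
      have e : (N : ℝ) * (θ' * (k * m)) = θ' * k * (N * m) := by ring
      have e2 : (k : ℝ) * (θ' * (c₀ + m)) = θ' * k * (c₀ + m) := by ring
      rw [e, e2]
      exact h7
    have h4 : (k : ℝ) * ((N : ℝ) * δ) ≤ k * (A * ε + θ' * (c₀ + m)) := by
      have e3 : (k : ℝ) * ((N : ℝ) * δ) = N * (k * δ) := by ring
      have e4 : (N : ℝ) * ((A / 4) * ε ^ 2 + θ' * (k * m)) =
          N * ((A / 4) * ε ^ 2) + N * (θ' * (k * m)) := by ring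
      have e5 : (k : ℝ) * (A * ε + θ' * (c₀ + m)) = k * (A * ε) + k * (θ' * (c₀ + m)) := by ring
      rw [e3, e5]
      rw [e4] at h5
      linarith only [h5, hNk, h6]
    have h7 : (N : ℝ) * δ ≤ A * ε + θ' * (c₀ + m) := le_of_mul_le_mul_left h4 hkpos
    have h8 : θ' * m ≤ g / 2 := by
      have h := mul_le_mul_of_nonneg_right hθ'1.le hm.le
      linarith only [h, hm2]
    have e6 : θ' * (c₀ + m) = θ' * c₀ + θ' * m := by ring
    rw [e6] at h7
    rw [hc']
    linarith only [h7, h8, hεA]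
  -- conclude: exponentiate `-(c'/N) + f n + F (n+1) ≤ f (n+1) + F n`
  have hδN : δ ≤ c' / N := by rw [le_div_iff₀ hNpos, mul_comm]; exact hNδ
  have key : -(c' / (N : ℝ)) + f n + F (n + 1) ≤ f (n + 1) + F n := by
    linarith only [hδN, hδ]
  have e1 : Real.exp (-(c' / (N : ℝ)) + f n + F (n + 1)) =
      Real.exp (-(c' / (N : ℝ))) * (a n * b (n + 1)) := by
    simp only [hf, hF]
    rw [Real.exp_add, Real.exp_add, Real.exp_log (hapos n), Real.exp_log (hbpos (n + 1))]
    ring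
  have e2 : Real.exp (f (n + 1) + F n) = a (n + 1) * b n := by
    simp only [hf, hF]
    rw [Real.exp_add, Real.exp_log (hapos (n + 1)), Real.exp_log (hbpos n)]
  have hfin := Real.exp_le_exp.2 key
  rw [e1, e2] at hfin
  simpa [ha, hb] using hfin

/-- **`BlockCrossover` from `AxialLogConvex` + (RV) + (SC) + (SL)** (the crux BY NAME, conditional):
the composition of line `registered` (`BlockCrossover_of`) applied to
`ratioCrossover_of_axialLogConvex_of_scaling` and the landed `stub_axialMass`, `stub_massVanishes`.
Witnesses: `p_k` any point of `(max p₁ p₀(c/(k+1)), p_c)`, `N_k = ⌈c/m_k⌉₊`, `C_k = 1`. -/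
theorem blockCrossover_of_axialLogConvex_of_scaling
    (hLCX : Summit.CriticalPhenomena.PercolationContinuityZ3.Theses.PercAxialLogConvexity.AxialLogConvex)
    (κ : ℝ)
    (hRV : ∀ ε : ℝ, 0 < ε → ∃ n₀ : ℕ, ∀ n j : ℕ, n₀ ≤ n → n ≤ 2 * j → j ≤ 2 * n →
      |Real.log (tau 3 (criticalProbI 3) 0 (Pi.single 0 (j : ℤ))) -
          Real.log (tau 3 (criticalProbI 3) 0 (Pi.single 0 (n : ℤ))) +
        κ * Real.log ((j : ℝ) / n)| ≤ ε)
    (D : ℝ → ℝ)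
    (hSC : ∀ lo hi : ℝ, 0 < lo → lo < hi → ∀ ε : ℝ, 0 < ε → ∃ p₀ : unitInterval,
      p₀ < criticalProbI 3 ∧ ∀ p : unitInterval, p₀ < p → p < criticalProbI 3 →
        ∀ m : ℝ, HasInvCorrLength (tau 3 p 0) m → ∀ n : ℕ, lo ≤ n * m → n * m ≤ hi →
          |(Real.log (tau 3 (criticalProbI 3) 0 (Pi.single 0 (n : ℤ))) -
              Real.log (tau 3 p 0 (Pi.single 0 (n : ℤ)))) - D (n * m)| ≤ ε)
    (c₀ θ : ℝ) (hc₀ : 0 < c₀) (hθ : θ < 1)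
    (hSL : ∀ t t' : ℝ, c₀ / 8 ≤ t' → t' ≤ t → t ≤ 2 * c₀ → D t - D t' ≤ θ * (t - t')) :
    Summit.CriticalPhenomena.PercolationContinuityZ3.Theses.PercAxialLogConvexity.BlockCrossover := by
  classical
  obtain ⟨c, c', hc, hcc', p₁, hp₁, H⟩ :=
    ratioCrossover_of_axialLogConvex_of_scaling hLCX κ hRV D hSC c₀ θ hc₀ hθ hSL
  have h1 := stub_axialMass
  have h2 := stub_massVanishes
  -- stub 2 at the tolerances ε_k := c / (k + 1)
  have h2' : ∀ k : ℕ, ∃ p₀ : unitInterval, p₀ < criticalProbI 3 ∧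
      ∀ p : unitInterval, p₀ < p → p < criticalProbI 3 →
        ∀ m : ℝ, HasInvCorrLength (tau 3 p 0) m → m < c / ((k : ℝ) + 1) :=
    fun k => h2 (c / ((k : ℝ) + 1)) (div_pos hc (Nat.cast_add_one_pos k))
  choose p₀ hp₀ hp₀m using h2'
  -- points p k ∈ (max (p₀ k) p₁, p_c)
  have hpk : ∀ k, ∃ p : unitInterval, max (p₀ k) p₁ < p ∧ p < criticalProbI 3 :=
    fun k => exists_between (max_lt (hp₀ k) hp₁)
  choose p hpmax hp₂ using hpk
  have hp₀p : ∀ k, p₀ k < p k := fun k => lt_of_le_of_lt (le_max_left _ _) (hpmax k)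
  have hp₁p : ∀ k, p₁ < p k := fun k => lt_of_le_of_lt (le_max_right _ _) (hpmax k)
  have hppos : ∀ k, 0 < (p k : ℝ) := fun k =>
    lt_of_le_of_lt (unitInterval.nonneg p₁) (Subtype.coe_lt_coe.2 (hp₁p k))
  -- stub 1's masses and sharp bounds at the points p k
  choose m hm hmicl hbd using fun k => h1 (p k) (hppos k) (hp₂ k)
  have hmlt : ∀ k, m k < c / ((k : ℝ) + 1) := fun k =>
    hp₀m k (p k) (hp₀p k) (hp₂ k) (m k) (hmicl k)
  refine ⟨c, c', hcc', p, fun k => ⌈c / m k⌉₊, fun _ => 1, ?_, ?_, ?_, ?_⟩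
  · intro k
    exact ⟨hppos k, (hp₂ k).le⟩
  · intro M
    refine ⟨M, ?_⟩
    show M ≤ ⌈c / m M⌉₊
    have hMlt : (M : ℝ) + 1 < c / m M := by
      rw [lt_div_iff₀ (hm M)]
      have h' := (lt_div_iff₀ (Nat.cast_add_one_pos M)).1 (hmlt M)
      linarith
    have hceil : c / m M ≤ ((⌈c / m M⌉₊ : ℕ) : ℝ) := Nat.le_ceil _
    have : (M : ℝ) ≤ ((⌈c / m M⌉₊ : ℕ) : ℝ) := by linarith
    exact_mod_cast this
  · intro k n
    show tau 3 (p k) 0 (Pi.single 0 (n : ℤ)) ≤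
      1 * Real.exp (-(c / ((⌈c / m k⌉₊ : ℕ) : ℝ)) * n)
    have hNpos : (0 : ℝ) < ((⌈c / m k⌉₊ : ℕ) : ℝ) := by
      have : 0 < ⌈c / m k⌉₊ := Nat.ceil_pos.2 (div_pos hc (hm k))
      exact_mod_cast this
    have hrate : c / ((⌈c / m k⌉₊ : ℕ) : ℝ) ≤ m k := by
      rw [div_le_iff₀ hNpos]
      have h0 : c / m k ≤ ((⌈c / m k⌉₊ : ℕ) : ℝ) := Nat.le_ceil _
      rw [div_le_iff₀ (hm k)] at h0
      linarith
    have hn : (0 : ℝ) ≤ n := n.cast_nonneg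
    have hmono : -(m k) * n ≤ -(c / ((⌈c / m k⌉₊ : ℕ) : ℝ)) * n := by
      have := mul_le_mul_of_nonneg_right hrate hn
      linarith
    calc tau 3 (p k) 0 (Pi.single 0 (n : ℤ)) ≤ Real.exp (-(m k) * n) := hbd k n
      _ ≤ Real.exp (-(c / ((⌈c / m k⌉₊ : ℕ) : ℝ)) * n) := Real.exp_le_exp.2 hmono
      _ = 1 * Real.exp (-(c / ((⌈c / m k⌉₊ : ℕ) : ℝ)) * n) := (one_mul _).symm
  · intro k n hNn hnN
    exact H (p k) (hp₁p k) (hp₂ k) (m k) (hm k) (hmicl k) n hNn hnN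

end Conditional

end Summit.CriticalPhenomena.PercolationContinuityZ3.Theorems.BlockCrossover

end
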